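import Summits.BirchSwinnertonDyer.BirchSwinnertonDyer.Theorems.KatoDescentPotSupersingularKatoFiniteLevelStrictKatoDialect
import HarnessLib

/-!
# Kato's (14.9.3) at finite level, part 11: WHERE THE TAMAGAWA TERM ENTERS — Kato §14.8 in the strict dialect:
# `#Sel_str^{ur}(K,E[p^∞]) ≤ #Sel_str^{0}(K,E[p^∞]) · ∏_{v ∈ T∖P} #H¹_ur(K_v,E[p^∞])` and `#Sel_str^{0} ≤ #Sel_{p^∞}(E/K)`
# (route `KatoDescentPotSupersingular` / `…Tame…`, crux M = stmt-BirchSwinnertonDyer-19196; route-free helper)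

Seat `bsd-potss-rkm` g17 (prover; cell `bsd-potss`), item stmt-BirchSwinnertonDyer-19196 `ReducibleKatoMember`
(`--supports … --as helper`; closes nothing).  HONEST FRAMING: BSD is not proved by any of this; nothing is booked;
theorems only (no definition, no named fact).

Kato §14.8 (p. 238): "`Sel(K,T) ⊂ S(K,T)` and `S(K,T)/Sel(K,T)` is a finite group which is embedded into the direct sum of
`H¹(K_v, T⊗ℚ/ℤ)/Image(H¹_f(K_v, T⊗ℚ)) = H¹(𝔽_v, H⁰(K_v^{ur}, T⊗ℚ/ℤ))/(div)` where `v` ranges over all finite places of `K` not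
lying over `p`" — for `T = T_pE`, `v ∤ p`: `H¹_f(K_v, V_pE) = 0` and the summand is `H¹_ur(K_v, E[p^∞])` (order `c_v^{(p)}`, the
`p`-part of the Tamagawa number, for a bad `v`).  Here, in the STRICT-at-`P` dialect of parts 3–10 (Kato's structure `𝓢∞`:
zero at `P ⊇ {v ∣ p}`, unramified at every other finite place; `𝓢⁰`: zero at every place of `T ⊇ P`, unramified — i.e. zero,
X11b `unramifiedSubgroup_primary_eq_bot` — outside):

* **`natCard_selmerGroup_strict_le_mul_prod_unramified`** — `#H¹_{𝓢∞} ≤ #H¹_{𝓢⁰} · ∏_{v ∈ T∖P} #H¹_ur(K_v, E[p^∞])`: the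
  localisation `c ↦ (loc_v c)_{v ∈ T∖P}` lands in `∏ H¹_ur(K_v,E[p^∞])` and its kernel lies in `H¹_{𝓢⁰}`.
* **`natCard_selmerGroup_zero_le_natCard_selmerGroupPInfty`** — `#H¹_{𝓢⁰} ≤ #Sel_{p^∞}(E/K)` (part 9: a class locally trivial
  at every finite place satisfies every `p^∞`-Selmer condition, `p` odd).
* **`natCard_selmerGroup_strict_le_selmerGroupPInfty_mul_prod`** — the product of the two; with part 9/10 this bounds Kato's
  `#H¹(O_K[1/p], E[p^k])` by `#Sel_{p^∞}(E/K) · ∏_{v∈T∖P} #H¹_ur(K_v,E[p^∞]) · ∏_{v∈P} #𝓚_v` for `k ≥ k₀`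
  (`exists_forall_le_natCard_selmerGroup_relaxed_le_intPow`): in rank `0`, `#Sel_{p^∞}(E/K) = #Ш[p^∞]` and the middle product is
  the Tamagawa term of Prop. 14.16 (2).

References: K. Kato, Astérisque 295 (2004) §14.8 (p. 238), (14.9.3), Prop. 14.16 [Kato2004Asterisque]; R. Greenberg, LNM 1716 §3–4
[GreenbergLNM1716].
-/

-- the summit and its single problem are both named `BirchSwinnertonDyer` (registry layout D-0017)
set_option linter.dupNamespace false
set_option autoImplicit false

noncomputable section

open scoped Classical ContRepresentation NumberField
open Function Field NumberField IsDedekindDomain WeierstrassCurve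
open Literature.NumberTheory.EllipticCurves Literature.NumberTheory.GaloisRepresentations
  Literature.NumberTheory.GaloisRepresentations.DiscreteGaloisModule Literature.NumberTheory.GaloisCohomology
open Literature.NumberTheory.EllipticCurves.Kato2004
open Summit.BirchSwinnertonDyer.Rank1Residual.X11b.LocBridge

namespace Summit.BirchSwinnertonDyer.BirchSwinnertonDyer.Theorems.KatoFiniteLevelCount

section Tamagawa

variable {K : Type} [Field K] [NumberField K] (W : WeierstrassCurve K) [W.IsElliptic] (p : ℕ) [Fact p.Prime]

/-- **`#Sel_str^{ur}(K,E[p^∞]) ≤ #Sel_str^{0}(K,E[p^∞]) · ∏_{v ∈ T∖P} #H¹_ur(K_v, E[p^∞])`** (Kato §14.8 in the strict dialect):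
the localisation of `H¹_{𝓢∞}` at the places of `T ∖ P` lands in `∏_{v∈T∖P} H¹_ur(K_v,E[p^∞])` (finite: `v ∤ p`, X11b) and its
kernel — classes locally trivial on `T ∖ P`, hence (structure) on all of `T`, unramified outside — lies in `H¹_{𝓢⁰}`.
[cite: Kato2004Asterisque, §14.8 (p. 238)] [cite: GreenbergLNM1716, §3 Lemma 3.3] -/
theorem natCard_selmerGroup_strict_le_mul_prod_unramified (hodd : p ≠ 2) (P T : Finset (HeightOneSpectrum (𝓞 K)))
    (hPT : P ⊆ T) (hT : ∀ v : HeightOneSpectrum (𝓞 K), v ∉ T → (p : 𝓞 K) ∉ v.asIdeal ∧ W.HasGoodReductionAt v)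
    (hPp : ∀ v : HeightOneSpectrum (𝓞 K), (p : 𝓞 K) ∈ v.asIdeal → v ∈ P)
    (𝓢inf 𝓢zero : SelmerStructure (primaryGaloisModule W p)) [Finite (W.selmerGroupPInfty p)]
    (hIP : ∀ v ∈ P, 𝓢inf (Sum.inr v) = ⊥)
    (hIur : ∀ v ∉ P, 𝓢inf (Sum.inr v) = unramifiedSubgroup (GaloisRep.toLocal v (primaryGaloisModule W p)) 1)
    (h0T : ∀ v ∈ T, 𝓢zero (Sum.inr v) = ⊥)
    (h0ur : ∀ v ∉ T, 𝓢zero (Sum.inr v) = unramifiedSubgroup (GaloisRep.toLocal v (primaryGaloisModule W p)) 1)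
    (h0inl : ∀ w : InfinitePlace K, 𝓢zero (Sum.inl w) = ⊤) :
    Nat.card 𝓢inf.selmerGroup ≤
      Nat.card 𝓢zero.selmerGroup *
        ∏ v ∈ T \ P, Nat.card (unramifiedSubgroup (GaloisRep.toLocal v (primaryGaloisModule W p)) 1) := by
  classical
  haveI : Finite 𝓢inf.selmerGroup :=
    finite_selmerGroup_strict_of_finite_selmerGroupPInfty W p hodd P T hT hPp 𝓢inf hIP hIur
  -- index set `T ∖ P` and the finite local targets
  let ι : Type := {v // v ∈ T \ P}
  have hι : ∀ v : ι, (v.1 ∈ T) ∧ v.1 ∉ P := fun v => Finset.mem_sdiff.1 v.2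
  haveI hfinloc : ∀ v : ι, Finite (galoisCohomology (GaloisRep.toLocal v.1 (primaryGaloisModule W p)) 1) := by
    intro v
    haveI : CharZero (v.1.adicCompletion K) := charZero_adicCompletion _
    exact finite_galoisCohomology_one_primary_toLocal W p v.1 (localEulerPoincareCharacteristic_holds _)
      (fun h => (hι v).2 (hPp _ h))
  -- the localisation lands in the unramified subgroups
  have hmem : ∀ (c : 𝓢inf.selmerGroup) (v : ι),
      galoisCohomology.localization (primaryGaloisModule W p) (Sum.inr v.1) 1
          (c : galoisCohomology (primaryGaloisModule W p) 1) ∈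
        unramifiedSubgroup (GaloisRep.toLocal v.1 (primaryGaloisModule W p)) 1 := by
    intro c v
    have h := (SelmerStructure.mem_selmerGroup_iff _ _).mp c.2 (Sum.inr v.1)
    rw [hIur v.1 (hι v).2] at h
    exact h
  let g : ∀ v : ι, 𝓢inf.selmerGroup →+ unramifiedSubgroup (GaloisRep.toLocal v.1 (primaryGaloisModule W p)) 1 := fun v =>
    { toFun := fun c => ⟨galoisCohomology.localization (primaryGaloisModule W p) (Sum.inr v.1) 1
          (c : galoisCohomology (primaryGaloisModule W p) 1), hmem c v⟩
      map_zero' := Subtype.ext (map_zero _)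
      map_add' := fun a b => Subtype.ext (map_add _ _ _) }
  let f := AddMonoidHom.pi g
  -- the kernel lies in `H¹_{𝓢⁰}`
  have hker : ∀ c : 𝓢inf.selmerGroup, f c = 0 → (c : galoisCohomology (primaryGaloisModule W p) 1) ∈ 𝓢zero.selmerGroup := by
    intro c hc
    have hcS := (SelmerStructure.mem_selmerGroup_iff _ _).mp c.2
    have hloc0 : ∀ v : HeightOneSpectrum (𝓞 K),
        galoisCohomology.localization (primaryGaloisModule W p) (Sum.inr v) 1
          (c : galoisCohomology (primaryGaloisModule W p) 1) = 0 :=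
      localization_eq_zero_of_mem_selmerGroup_strict W p P T hT 𝓢inf hIP hIur c.2 fun v hvT hvP => by
        exact congrArg Subtype.val (congrFun hc ⟨v, Finset.mem_sdiff.2 ⟨hvT, hvP⟩⟩)
    refine (SelmerStructure.mem_selmerGroup_iff _ _).mpr fun pl => ?_
    rcases pl with w | v
    · rw [h0inl w]; exact AddSubgroup.mem_top _
    · by_cases hvT : v ∈ T
      · rw [h0T v hvT]; exact (AddSubgroup.mem_bot).mpr (hloc0 v)
      · rw [h0ur v hvT]
        by_cases hvP : v ∈ P
        · exact absurd (hPT hvP) hvT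
        · have h := hcS (Sum.inr v); rw [hIur v hvP] at h; exact h
  -- count: `#H¹_{𝓢∞} = #ker · #range ≤ #H¹_{𝓢⁰} · #(∏ H¹_ur)`
  have hker_le : Nat.card f.ker ≤ Nat.card 𝓢zero.selmerGroup := by
    haveI : Finite 𝓢zero.selmerGroup :=
      finite_selmerGroup_strict_of_finite_selmerGroupPInfty W p hodd T T hT (fun v hv => hPT (hPp v hv)) 𝓢zero h0T h0ur
    refine Nat.card_le_card_of_injective
      (fun c : f.ker => (⟨((c : 𝓢inf.selmerGroup) : galoisCohomology (primaryGaloisModule W p) 1),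
        hker (c : 𝓢inf.selmerGroup) ((AddMonoidHom.mem_ker).1 c.2)⟩ : 𝓢zero.selmerGroup)) fun a b h => ?_
    apply Subtype.ext
    apply Subtype.ext
    exact congrArg (fun x : 𝓢zero.selmerGroup => (x : galoisCohomology (primaryGaloisModule W p) 1)) h
  have hrange_le : Nat.card f.range ≤
      ∏ v ∈ T \ P, Nat.card (unramifiedSubgroup (GaloisRep.toLocal v (primaryGaloisModule W p)) 1) := by
    haveI : ∀ v : ι, Finite (unramifiedSubgroup (GaloisRep.toLocal v.1 (primaryGaloisModule W p)) 1) := fun v =>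
      inferInstance
    rw [← Finset.prod_coe_sort, ← Nat.card_pi]
    exact Nat.card_le_card_of_injective _ f.range.subtype_injective
  calc Nat.card 𝓢inf.selmerGroup = Nat.card f.ker * Nat.card f.range := by
        rw [AddSubgroup.card_eq_card_quotient_mul_card_addSubgroup f.ker, mul_comm,
          Nat.card_congr (QuotientAddGroup.quotientKerEquivRange f).toEquiv]
    _ ≤ Nat.card 𝓢zero.selmerGroup *
        ∏ v ∈ T \ P, Nat.card (unramifiedSubgroup (GaloisRep.toLocal v (primaryGaloisModule W p)) 1) :=
      Nat.mul_le_mul hker_le hrange_le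

/-- **`#Sel_str^{0}(K,E[p^∞]) ≤ #Sel_{p^∞}(E/K)`**: a class of `H¹_{𝓢⁰}` is locally trivial at every finite place (zero on `T`,
`H¹_ur = 0` off `T`), hence in `Sel_{p^∞}(E/K)` (part 9, `p` odd). [cite: Kato2004Asterisque, §14.8 (p. 238)] -/
theorem natCard_selmerGroup_zero_le_natCard_selmerGroupPInfty (hodd : p ≠ 2) (T : Finset (HeightOneSpectrum (𝓞 K)))
    (hT : ∀ v : HeightOneSpectrum (𝓞 K), v ∉ T → (p : 𝓞 K) ∉ v.asIdeal ∧ W.HasGoodReductionAt v)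
    (𝓢zero : SelmerStructure (primaryGaloisModule W p)) [Finite (W.selmerGroupPInfty p)]
    (h0T : ∀ v ∈ T, 𝓢zero (Sum.inr v) = ⊥)
    (h0ur : ∀ v ∉ T, 𝓢zero (Sum.inr v) = unramifiedSubgroup (GaloisRep.toLocal v (primaryGaloisModule W p)) 1) :
    Nat.card 𝓢zero.selmerGroup ≤ Nat.card (W.selmerGroupPInfty p) := by
  refine Nat.card_le_card_of_injective
    (fun c : 𝓢zero.selmerGroup => (⟨(c : galoisCohomology (primaryGaloisModule W p) 1),
      mem_selmerGroupPInfty_of_forall_localization_eq_zero W p hodd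
        (localization_eq_zero_of_mem_selmerGroup_strict W p T T hT 𝓢zero h0T h0ur c.2
          fun v hvT hvT' => absurd hvT hvT')⟩ : W.selmerGroupPInfty p)) fun a b h => ?_
  apply Subtype.ext
  exact congrArg (fun x : W.selmerGroupPInfty p => (x : W.galH1Primary p)) h

/-- **`#Sel_str^{ur}(K,E[p^∞]) ≤ #Sel_{p^∞}(E/K) · ∏_{v ∈ T∖P} #H¹_ur(K_v, E[p^∞])`** — the two previous bounds combined
(`𝓢⁰` any structure zero on `T`, unramified outside, everything at `∞`; one exists whenever `𝓢∞` does, e.g. `𝓢∞` with its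
`T ∖ P` conditions replaced by `⊥` — supplied by the caller). [cite: Kato2004Asterisque, §14.8 (p. 238)] -/
theorem natCard_selmerGroup_strict_le_selmerGroupPInfty_mul_prod (hodd : p ≠ 2) (P T : Finset (HeightOneSpectrum (𝓞 K)))
    (hPT : P ⊆ T) (hT : ∀ v : HeightOneSpectrum (𝓞 K), v ∉ T → (p : 𝓞 K) ∉ v.asIdeal ∧ W.HasGoodReductionAt v)
    (hPp : ∀ v : HeightOneSpectrum (𝓞 K), (p : 𝓞 K) ∈ v.asIdeal → v ∈ P)
    (𝓢inf 𝓢zero : SelmerStructure (primaryGaloisModule W p)) [Finite (W.selmerGroupPInfty p)]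
    (hIP : ∀ v ∈ P, 𝓢inf (Sum.inr v) = ⊥)
    (hIur : ∀ v ∉ P, 𝓢inf (Sum.inr v) = unramifiedSubgroup (GaloisRep.toLocal v (primaryGaloisModule W p)) 1)
    (h0T : ∀ v ∈ T, 𝓢zero (Sum.inr v) = ⊥)
    (h0ur : ∀ v ∉ T, 𝓢zero (Sum.inr v) = unramifiedSubgroup (GaloisRep.toLocal v (primaryGaloisModule W p)) 1)
    (h0inl : ∀ w : InfinitePlace K, 𝓢zero (Sum.inl w) = ⊤) :
    Nat.card 𝓢inf.selmerGroup ≤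
      Nat.card (W.selmerGroupPInfty p) *
        ∏ v ∈ T \ P, Nat.card (unramifiedSubgroup (GaloisRep.toLocal v (primaryGaloisModule W p)) 1) :=
  (natCard_selmerGroup_strict_le_mul_prod_unramified W p hodd P T hPT hT hPp 𝓢inf 𝓢zero hIP hIur h0T h0ur h0inl).trans
    (Nat.mul_le_mul_right _ (natCard_selmerGroup_zero_le_natCard_selmerGroupPInfty W p hodd T hT 𝓢zero h0T h0ur))

/-- **Kato's Prop. 14.16 (2) shape at finite level**: for `k ≥ k₀`, every Poitou–Tate family at level `p^k` and every Kato pair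
`𝓢 ≤ ℛ` on `W.torsionGaloisModule ((p:ℤ)^k)`,
**`#H¹_ℛ(K, E[p^k]) ≤ #Sel_{p^∞}(E/K) · ∏_{v∈T∖P} #H¹_ur(K_v, E[p^∞]) · ∏_{v∈P} #𝓚_v`** — in rank `0` the three factors are
`#Ш(E/K)[p^∞]`, the (`p`-parts of the) Tamagawa numbers at the bad places, and `#E(K_v)[p^k]·#(𝓞_v/p^k)` at `v ∣ p`.
[cite: Kato2004Asterisque, §14.8 (p. 238), (14.9.3) (p. 240), Prop. 14.16 (2) (p. 244)] -/
theorem exists_forall_le_natCard_selmerGroup_relaxed_le_intPow (hodd : p ≠ 2) (P T : Finset (HeightOneSpectrum (𝓞 K)))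
    (hPT : P ⊆ T) (hT : ∀ v : HeightOneSpectrum (𝓞 K), v ∉ T → (p : 𝓞 K) ∉ v.asIdeal ∧ W.HasGoodReductionAt v)
    (hPp : ∀ v : HeightOneSpectrum (𝓞 K), (p : 𝓞 K) ∈ v.asIdeal → v ∈ P)
    (𝓢inf 𝓢zero : SelmerStructure (primaryGaloisModule W p)) [Finite (W.selmerGroupPInfty p)]
    (hIP : ∀ v ∈ P, 𝓢inf (Sum.inr v) = ⊥)
    (hIur : ∀ v ∉ P, 𝓢inf (Sum.inr v) = unramifiedSubgroup (GaloisRep.toLocal v (primaryGaloisModule W p)) 1)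
    (hIinl : ∀ w : InfinitePlace K, 𝓢inf (Sum.inl w) = ⊤)
    (h0T : ∀ v ∈ T, 𝓢zero (Sum.inr v) = ⊥)
    (h0ur : ∀ v ∉ T, 𝓢zero (Sum.inr v) = unramifiedSubgroup (GaloisRep.toLocal v (primaryGaloisModule W p)) 1)
    (h0inl : ∀ w : InfinitePlace K, 𝓢zero (Sum.inl w) = ⊤) {v₀ : HeightOneSpectrum (𝓞 K)} (hv₀P : v₀ ∈ P) :
    ∃ k₀ : ℕ, ∀ k, k₀ ≤ k →
      ∀ (inv : LocalInvariants K (p ^ k)), inv.IsPerfect → inv.SumLocalTermEqZero → inv.SelmerComplement →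
      ∀ (𝓢 ℛ : SelmerStructure (W.torsionGaloisModule ((p : ℤ) ^ k))),
        (∀ v ∈ P, 𝓢 (Sum.inr v) = ⊥) → (∀ v ∈ P, ℛ (Sum.inr v) = ⊤) →
        (∀ v ∉ P, 𝓢 (Sum.inr v) = unramifiedSubgroup (GaloisRep.toLocal v (W.torsionGaloisModule ((p : ℤ) ^ k))) 1) →
        (∀ v ∉ P, ℛ (Sum.inr v) = unramifiedSubgroup (GaloisRep.toLocal v (W.torsionGaloisModule ((p : ℤ) ^ k))) 1) →
        Nat.card ℛ.selmerGroup ≤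
          Nat.card (W.selmerGroupPInfty p) *
            (∏ v ∈ T \ P, Nat.card (unramifiedSubgroup (GaloisRep.toLocal v (primaryGaloisModule W p)) 1)) *
            ∏ v ∈ P, Nat.card (W.kummerSelmerStructure ((p : ℤ) ^ k) (Sum.inr v)) := by
  obtain ⟨k₀, hk₀⟩ := exists_forall_le_natCard_selmerGroup_relaxed_eq_of_finite_selmerGroupPInfty_intPow W p hodd P T
    hPT hT hPp 𝓢inf hIP hIur hIinl hv₀P
  refine ⟨k₀, fun k hk inv hperf hsum hcompl 𝓢 ℛ h𝓢P hℛP h𝓢ur hℛur => ?_⟩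
  rw [hk₀ k hk inv hperf hsum hcompl 𝓢 ℛ h𝓢P hℛP h𝓢ur hℛur]
  exact Nat.mul_le_mul_right _
    (natCard_selmerGroup_strict_le_selmerGroupPInfty_mul_prod W p hodd P T hPT hT hPp 𝓢inf 𝓢zero hIP hIur h0T h0ur h0inl)

end Tamagawa

end Summit.BirchSwinnertonDyer.BirchSwinnertonDyer.Theorems.KatoFiniteLevelCount

end
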